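import Mathlib
import Summits.MatrixMultiplication.MatrixMultiplication.Theorems.SnSubsetDichotomyHyperoctahedralSubsetsDisjointWalks

/-!
# `SnSubsetDichotomy.HyperoctahedralSubsets`, line `spherical-rank-sieve` — the Ξ-form slide bound (supply − slides > 0 ⇒ clean pair)

Crux `stmt-MatrixMultiplication-8305` (`HyperoctahedralSubsets`), co-lead c2 brick `stub_slideBound` (`--supports`).

The union-bound route to the open core (c1 memo `LeadC1-PoorCore.md` §2–4, twin NOTES §11 (WM), my memo
`LeadC2-ScaleWall.md` §2–3) compares, for a cyclic colour word `col` of length `k + 2`, the SUPPLY of ordered pairs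
of distinct closed walks of `col` with the SLIDES `Ξ(col) = Σ_{i ≠ j} |Z_i ∩ Z_j|`, where `Z_i` is the set of
`i`-th points of the (injective) closed walks of `col` (a point of `Z_i ∩ Z_j` is a vertex at which `col` closes in
two different rotations).  This file proves the counting interface between the two, in the registered vocabulary:

* `SlideBound.card_meeting_le` — the ordered pairs `(p, q)` of injective closed walks of `col` that MEET
  (`p i = q j` for some `i, j`; necessarily `i ≠ j` when `p ≠ q`, by forward determination) number at most
  `Σ_{i ≠ j} |Z_i ∩ Z_j|`: the pair is recovered from `(i, j, p i)` because a closed walk of `col` is determined by any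
  one of its points (`DisjointWalks.eq_of_apply_eq`, landed by lead -1);
* `stub_slideBound` — consequently, if `|I|(|I| − 1) > Σ_{i ≠ j} |Z_i ∩ Z_j|` (`I` = injective closed walks of `col`), two
  of them are point-disjoint; with the twin line's landed `stub_cycleGadget` that is a commuting local triple supported
  on the two cycles.  The trivial estimate `|Z_i ∩ Z_j| ≤ |Z_i| = |I|` recovers the familiar threshold `|I| > (k+2)(k+1) + 1`
  (`slideBound_trivial`); the point of the Ξ-form is that a (WM)/(TSA)-type hypothesis bounds `Σ_{i≠j}|Z_i ∩ Z_j|` by a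
  small multiple of `|I|` summed over words, which is exactly what this interface consumes.

Pure finite combinatorics; no involution or fixed-point-freeness hypothesis is needed for the counting (they enter only
through `stub_cycleGadget` downstream).
-/

-- the project's summit namespace `Summit.MatrixMultiplication.MatrixMultiplication` repeats a component by design (D-0022)
set_option linter.dupNamespace false

namespace Summit.MatrixMultiplication.MatrixMultiplication.Theorems.HyperoctahedralSubsets

namespace SlideBound

variable {n k : ℕ}

/-- Two closed walks of the same colour word that meet at positions `(i, j)` with `i = j` are equal (forward
determination); so distinct closed walks can only meet at different positions. [folklore] -/
theorem ne_of_meet (μ : Fin 3 → Equiv.Perm (Fin n)) (col : Fin (k + 2) → Fin 3)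
    {p q : Fin (k + 2) → Fin n} (hp : ∀ i, μ (col i) (p i) = p (i + 1))
    (hq : ∀ i, μ (col i) (q i) = q (i + 1)) (hpq : p ≠ q) {i j : Fin (k + 2)} (h : p i = q j) : i ≠ j := by
  rintro rfl
  exact hpq (DisjointWalks.eq_of_apply_eq μ col hp hq h)

/-- **Meeting pairs are controlled by the slides.**  For a finset `I` of closed walks of `col`, the ordered pairs
`(p, q) ∈ I × I`, `p ≠ q`, with `p i = q j` for some positions `i, j` number at most
`Σ_{(i,j), i ≠ j} |I.image (· i) ∩ I.image (· j)|`: such a pair meets at some `(i, j)` with `i ≠ j`, and for fixed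
`(i, j)` the map `(p, q) ↦ p i` is injective on the pairs meeting at `(i, j)` (a closed walk of `col` is determined by
one point) with values in `Z_i ∩ Z_j`. [folklore] -/
theorem card_meeting_le (μ : Fin 3 → Equiv.Perm (Fin n)) (col : Fin (k + 2) → Fin 3)
    (I : Finset (Fin (k + 2) → Fin n)) (hI : ∀ p ∈ I, ∀ i, μ (col i) (p i) = p (i + 1)) :
    ((I ×ˢ I).filter (fun pq => pq.1 ≠ pq.2 ∧ ∃ i j, pq.1 i = pq.2 j)).card ≤
      ∑ ij ∈ (Finset.univ : Finset (Fin (k + 2) × Fin (k + 2))).filter (fun ij => ij.1 ≠ ij.2),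
        (I.image (fun p => p ij.1) ∩ I.image (fun p => p ij.2)).card := by
  classical
  -- cover the meeting pairs by the pairs meeting at a fixed `(i, j)`, `i ≠ j`
  set M : Fin (k + 2) × Fin (k + 2) → Finset ((Fin (k + 2) → Fin n) × (Fin (k + 2) → Fin n)) :=
    fun ij => (I ×ˢ I).filter (fun pq => pq.1 ij.1 = pq.2 ij.2) with hM
  have hcover : (I ×ˢ I).filter (fun pq => pq.1 ≠ pq.2 ∧ ∃ i j, pq.1 i = pq.2 j) ⊆
      ((Finset.univ : Finset (Fin (k + 2) × Fin (k + 2))).filter (fun ij => ij.1 ≠ ij.2)).biUnion M := by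
    intro pq hpq
    simp only [Finset.mem_filter, Finset.mem_product] at hpq
    obtain ⟨⟨hp, hq⟩, hne, i, j, hij⟩ := hpq
    simp only [Finset.mem_biUnion, Finset.mem_filter, Finset.mem_univ, true_and, hM, Finset.mem_product]
    exact ⟨(i, j), ne_of_meet μ col (hI _ hp) (hI _ hq) hne hij, ⟨hp, hq⟩, hij⟩
  refine (Finset.card_le_card hcover).trans ((Finset.card_biUnion_le).trans (Finset.sum_le_sum fun ij _ => ?_))
  -- for fixed `(i, j)`: `(p, q) ↦ p i` is injective on `M (i, j)` with values in `Z_i ∩ Z_j`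
  refine Finset.card_le_card_of_injOn (fun pq => pq.1 ij.1) (fun pq hpq => ?_) ?_
  · simp only [hM, Finset.coe_filter, Finset.mem_product, Set.mem_setOf_eq] at hpq
    obtain ⟨⟨hp, hq⟩, he⟩ := hpq
    simp only [Finset.coe_inter, Finset.coe_image, Set.mem_inter_iff, Set.mem_image, Finset.mem_coe]
    exact ⟨⟨pq.1, hp, rfl⟩, ⟨pq.2, hq, he.symm⟩⟩
  · rintro ⟨p, q⟩ hpq ⟨p', q'⟩ hpq' he
    simp only [hM, Finset.coe_filter, Finset.mem_product, Set.mem_setOf_eq] at hpq hpq'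
    obtain ⟨⟨hp, hq⟩, hij⟩ := hpq
    obtain ⟨⟨hp', hq'⟩, hij'⟩ := hpq'
    simp only at he
    have epp : p = p' := DisjointWalks.eq_of_apply_eq μ col (hI _ hp) (hI _ hp') he
    have eqq : q = q' :=
      DisjointWalks.eq_of_apply_eq μ col (hI _ hq) (hI _ hq') (by rw [← hij, he, hij'])
    rw [epp, eqq]

end SlideBound

/-- **Stub `stub_slideBound` — supply minus slides gives a point-disjoint pair** (crux
`SnSubsetDichotomy.HyperoctahedralSubsets`, stmt-MatrixMultiplication-8305, line `spherical-rank-sieve`; c2 brick).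
Let `col` be a colour word of length `k + 2` and `I` a finset of closed walks of `col`
(`μ (col i) (p i) = p (i + 1)` for all `i`, indices mod `k + 2`).  If the number of ordered pairs of distinct members
of `I` exceeds the slide count `Σ_{(i,j), i ≠ j} |I.image (· i) ∩ I.image (· j)|`, then `I` contains two members that
share no point (`p i ≠ q j` for all `i, j`).  (Feed them, if injective, to `stub_cycleGadget`.) [folklore] -/
theorem stub_slideBound : ∀ (n k : ℕ) (μ : Fin 3 → Equiv.Perm (Fin n)) (col : Fin (k + 2) → Fin 3) (I : Finset (Fin (k + 2) → Fin n)), (∀ p ∈ I, ∀ i, μ (col i) (p i) = p (i + 1)) → (∑ ij ∈ (Finset.univ : Finset (Fin (k + 2) × Fin (k + 2))).filter (fun ij => ij.1 ≠ ij.2), (I.image (fun p => p ij.1) ∩ I.image (fun p => p ij.2)).card) < I.card * (I.card - 1) → ∃ p ∈ I, ∃ q ∈ I, p ≠ q ∧ ∀ i j, p i ≠ q j := by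
  intro n k μ col I hI hlt
  classical
  -- ordered pairs of distinct members: `|I| (|I| - 1)` of them
  have hoff : ((I ×ˢ I).filter (fun pq => pq.1 ≠ pq.2)).card = I.card * (I.card - 1) := by
    rw [Nat.mul_sub_one, ← Finset.offDiag_card]
    congr 1
    ext pq
    simp only [Finset.mem_filter, Finset.mem_product, Finset.mem_offDiag, and_assoc]
  -- not all of them meet
  have hmeet := SlideBound.card_meeting_le μ col I hI
  have hsub : ¬ ((I ×ˢ I).filter (fun pq => pq.1 ≠ pq.2) ⊆
      (I ×ˢ I).filter (fun pq => pq.1 ≠ pq.2 ∧ ∃ i j, pq.1 i = pq.2 j)) := by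
    intro h
    have h' := lt_of_le_of_lt ((Finset.card_le_card h).trans hmeet) hlt
    rw [hoff] at h'
    exact lt_irrefl _ h'
  rw [Finset.not_subset] at hsub
  obtain ⟨⟨p, q⟩, hmem, hnot⟩ := hsub
  simp only [Finset.mem_filter, Finset.mem_product] at hmem hnot
  obtain ⟨⟨hp, hq⟩, hne⟩ := hmem
  refine ⟨p, hp, q, hq, hne, fun i j hij => hnot ⟨⟨hp, hq⟩, hne, i, j, hij⟩⟩

/-- The trivial estimate `|Z_i ∩ Z_j| ≤ |Z_i| ≤ |I|` turns `stub_slideBound` into the familiar threshold (cf.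
`DisjointWalks`): if `(k + 2)² |I| < |I| (|I| − 1)`, i.e. `|I| > (k + 2)² + 1`, then two members of `I` share no
point. [folklore] -/
theorem slideBound_trivial (n k : ℕ) (μ : Fin 3 → Equiv.Perm (Fin n)) (col : Fin (k + 2) → Fin 3)
    (I : Finset (Fin (k + 2) → Fin n)) (hI : ∀ p ∈ I, ∀ i, μ (col i) (p i) = p (i + 1))
    (hbig : (k + 2) * (k + 2) * I.card < I.card * (I.card - 1)) :
    ∃ p ∈ I, ∃ q ∈ I, p ≠ q ∧ ∀ i j, p i ≠ q j := by
  classical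
  refine stub_slideBound n k μ col I hI (lt_of_le_of_lt ?_ hbig)
  calc ∑ ij ∈ (Finset.univ : Finset (Fin (k + 2) × Fin (k + 2))).filter (fun ij => ij.1 ≠ ij.2),
          (I.image (fun p => p ij.1) ∩ I.image (fun p => p ij.2)).card
      ≤ ∑ _ij ∈ (Finset.univ : Finset (Fin (k + 2) × Fin (k + 2))).filter (fun ij => ij.1 ≠ ij.2), I.card :=
        Finset.sum_le_sum fun ij _ =>
          (Finset.card_le_card Finset.inter_subset_left).trans Finset.card_image_le
    _ ≤ ∑ _ij ∈ (Finset.univ : Finset (Fin (k + 2) × Fin (k + 2))), I.card :=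
        Finset.sum_le_sum_of_subset_of_nonneg (Finset.filter_subset _ _) fun _ _ _ => Nat.zero_le _
    _ = (k + 2) * (k + 2) * I.card := by
        rw [Finset.sum_const, Finset.card_univ, Fintype.card_prod, Fintype.card_fin, smul_eq_mul]

end Summit.MatrixMultiplication.MatrixMultiplication.Theorems.HyperoctahedralSubsets
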